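import Literature.Geometry.Hyperkaehler.TrianalyticSubvariety
import Literature.AlgebraicGeometry.HodgeTheory.KaehlerClassHodgeType
import Literature.AlgebraicGeometry.HodgeTheory.GysinFormalism
import Literature.AlgebraicGeometry.Motives.Varieties
import HarnessLib

/-!
# Verbitsky's criterion: a complex surface of `SU(2)`-invariant degree is trianalytic

Named fact (D-0014) for the layer `Literature/Geometry/Hyperkaehler`, stated against the tree's
notion `IsTrianalytic` (`TrianalyticSubvariety.lean`, whose module docstring lists this theorem under
"What is NOT here": "Theorem 4.1 (`[N]` `SU(2)`-invariant ⇒ `N` trianalytic) and its numerical form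
for surfaces (`∫_N ω_I² = ∫_N ω_J²` ⇒ `J(T_xN) = T_xN` on `N⁰`)"). Wanted by the Hodge-conjecture crux
`NikulinSerreCarrier` (stmt-HodgeConjecture-14464), line `modular-twin-address`, stub
`stub_trianalyticRestriction` (an algebraic surface `g : Y ↪ M` inside a hyperkähler `M^an` whose
three restricted Kähler classes have cup matrix `c·𝟙`).

## Source (read)

M. Verbitsky, *Tri-analytic subvarieties of hyperkaehler manifolds*, GAFA 5 (1995) 92–104
(= alg-geom/9403006, *Hyperkähler embeddings and holomorphic symplectic geometry II*), §4 of the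
journal text = §3 "When analytic implies tri-analytic" of the arXiv text (read in full):

* **Theorem 4.1** (so numbered when quoted in Verbitsky, *Hyperholomorphic sheaves and new examples
  of hyperkähler manifolds*, alg-geom/9712012, §2.3: "This is Theorem 4.1 of [V-II]"): "Let
  `N ⊂ (M, I)` be a closed analytic subvariety of `(M, I)`, `dim_ℂ N = n` … Assume that
  `⟨N⟩ ∈ H^{2m−2n}(M)` is invariant with respect to the action of `G_M = SU(2)` on `H^{2m−2n}(M)`.
  Then `N` is tri-analytic."
* Its proof is the chain: (Proposition, Wirtinger's inequality) `η_W ≤ 2ⁿ` with equality iff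
  `I(W) = W`; (Proposition "`N` is analytic iff `η` is constant") `N` is analytic with respect to the
  induced complex structure `J` iff `η_J(x) = 2ⁿ` for all `x ∈ N⁰`, i.e. iff `J(T_xN) = T_xN` on the
  non-singular locus; (Proposition "analyticity in terms of integrals")
  "`∫_{N⁰} φ^*(ω_Jⁿ) = 2ⁿ ∫_{N⁰} Vol` if and only if `N` is analytic with respect to `J`", where
  `2ⁿ ∫ Vol = ∫ φ^* ω_Iⁿ` because `N` is `I`-analytic; and finally the `𝔰𝔬(5)`-argument showing that
  `G_M`-invariance of `⟨N⟩` makes `⟨[N], ω_Lⁿ⟩` independent of the induced complex structure `L`.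
  The same chain is restated in alg-geom/9712012 §2.3, Proposition (Wirtinger's inequality): "Let
  `X ⊂ (M, I)` be a closed complex subvariety of complex dimension `k` … `deg_I X := ∫_X ω_I^k`,
  `deg_J X := ∫_X ω_J^k`. Then `deg_I X ≥ |deg_J X|`, and the inequality is strict unless `X` is
  trianalytic."

## What is recorded, and why in this form

The tree has no `SU(2)`-action on the cohomology of a hyperkähler manifold and no fundamental class of
an analytic subvariety of an abstract complex manifold, but it has everything needed to state the
theorem in the NUMERICAL form its proof passes through, for the case the consumer needs — a smooth
projective SURFACE `Y` embedded by an algebraic closed immersion `g : Y ⟶ M` into a smooth projective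
`M` whose analytification (a Hodge model `A : HodgeModel k M`, `RationalHodgeClasses.lean`) carries a
hyperkähler triple `(gm, I, J, K)` (`IsHyperkaehlerTriple`). For a surface, `L ↦ ⟨[N], ω_L²⟩`
(`L = aI + bJ + cK` on the twistor sphere) is the quadratic form of the `3 × 3` matrix of the numbers
`∫_N ω_L ∧ ω_{L'}`, `L, L' ∈ {I, J, K}`; it is constant on the sphere — the conclusion of the
`𝔰𝔬(5)` step, and trivially implied by `SU(2)`-invariance of `[N]` — iff that matrix is scalar. Read
through a natural real de Rham comparison `e` (`DeRhamIsoFamily`, `.IsNatural`; natural families are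
unique up to a non-zero real scalar in each degree, which does not affect the condition) and the
comparison homeomorphism `A.toComplexPoints`, the three Kähler classes `[ω_I], [ω_J], [ω_K]` become
classes `κ_I, κ_J, κ_K ∈ H²(M(ℂ); ℂ)`, and the matrix becomes the cup products
`g^*κ_L ∪ g^*κ_{L'} ∈ H⁴(Y(ℂ); ℂ) ≅ ℂ`. HYPOTHESIS: equal diagonal, zero off-diagonal. CONCLUSION:
`N = A.toComplexPoints ⁻¹' g(Y)(ℂ)` is trianalytic in the tree's sense (`IsTrianalytic J K N`: a closed
analytic subset of `(A.carrier, I)` whose tangent space at every regular point is stable under every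
induced complex structure — for the smooth `N = g(Y)^an` this is verbatim Verbitsky's
"`L(T_xN) = T_xN` for all `x ∈ N⁰ = N`"). No sign or normalisation hypothesis is needed: the diagonal
entry for `L = I` is `2·vol(N) > 0` whatever the scalar in `e`, so the hypothesis says exactly
`⟨[N], ω_L²⟩ = ⟨[N], ω_I²⟩` for all induced `L`, and Verbitsky's Propositions give `L(T_xN) = T_xN`.
The consumer's "cup matrix `= c • p_Y`, `c > 0`" is the special case of a chosen generator `p_Y`.

Deliberately NOT here: the cohomological `SU(2)`-action and the literal Theorem 4.1 for classes of
arbitrary codimension (needs fundamental classes of analytic cycles in `H^*(A.carrier)`); the converse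
(trianalytic ⇒ invariant degrees); higher-dimensional `Y` (the condition is then on a form of degree
`dim Y` in `(a, b, c)`, not on a `3 × 3` matrix).

## References

* [Verbitsky1995Trianalytic] M. Verbitsky, GAFA 5 (1995) 92–104 = alg-geom/9403006, §4 Thm. 4.1 and
  its proof (arXiv §3: Propositions "Wirtinger's inequality", "`N` is analytic iff `η` is constant",
  "analyticity in terms of integrals") (read).
* [Verbitsky1997HyperholomorphicSheaves] M. Verbitsky, alg-geom/9712012, §2.3 (Definition of
  trianalytic, Theorem "= Thm. 4.1 of [V-II]", Proposition "Wirtinger's inequality") (read).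
-/

noncomputable section

open scoped Manifold ContDiff
open CategoryTheory
open Literature.AlgebraicGeometry.Motives (SchemeOver IsSmoothProjective AlgPoints)
open Literature.AlgebraicGeometry.HodgeTheory
open Literature.AlgebraicTopology.SingularHomology (cupProduct)
open Literature.Geometry.Kaehler
open Literature.NumberTheory.Transcendental (DeRhamIsoFamily)

namespace Literature.Geometry.Hyperkaehler

/-- **Verbitsky's trianalyticity criterion, numerical form for surfaces** (named fact). Let `M` be a
smooth projective complex variety of dimension `k` with Hodge model `A` (its analytification), carrying
a smooth Riemannian metric `gm` and endomorphism fields `J, K` forming a hyperkähler triple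
`(gm, I, J, K)`; let `e` be a natural real de Rham comparison family and `κ_I, κ_J, κ_K ∈ H²(M(ℂ); ℂ)`
the classes corresponding under `A.toComplexPoints` and `e` to the three Kähler classes
`[ω_I], [ω_J], [ω_K]`. Let `g : Y ⟶ M` be a closed immersion of a smooth projective surface such that
the cup products `g^*κ_L ∪ g^*κ_{L'} ∈ H⁴(Y(ℂ); ℂ)` have equal diagonal and vanishing off-diagonal
entries — i.e. `⟨[N], ω_L²⟩` is the same for every induced complex structure `L = aI + bJ + cK`,
which is Verbitsky's consequence of the `SU(2)`-invariance of the class of `N = g(Y)`. Then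
`N^an = A.toComplexPoints ⁻¹' g(Y)(ℂ)` is a trianalytic subset of `(A.carrier, I, J, K)`: by
Wirtinger's inequality `⟨[N], ω_L²⟩ ≤ ⟨[N], ω_I²⟩ = 2 vol(N)` with equality iff `L(T_xN) = T_xN` at
every non-singular point. [cite: Verbitsky1995Trianalytic, §4 Thm. 4.1 and its proof (arXiv alg-geom/9403006 §3, Propositions "N is analytic iff eta is constant" and "analyticity in terms of integrals")] -/
def Verbitsky1995_isTrianalytic_of_cupMatrix : Prop :=
  ∀ (k : ℕ) (M Y : SchemeOver ℂ), IsSmoothProjective k M → IsSmoothProjective 2 Y →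
    ∀ (g : Y ⟶ M), AlgebraicGeometry.IsClosedImmersion g.left →
    ∀ (A : HodgeModel k M)
      (gm : Bundle.ContMDiffRiemannianMetric 𝓘(ℝ, A.model) ∞ A.model
        (fun x : A.carrier ↦ TangentSpace 𝓘(ℝ, A.model) x))
      (J K : ∀ x : A.carrier, TangentSpace 𝓘(ℝ, A.model) x →L[ℝ] TangentSpace 𝓘(ℝ, A.model) x)
      (hHK : IsHyperkaehlerTriple gm.toRiemannianMetric J K)
      (hω : isSmoothForm_kaehlerForm_of_isManifold_complex (E := A.model) (M := A.carrier))
      (e : DeRhamIsoFamily 𝓘(ℝ, A.model)), e.IsNatural →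
    ∀ (κI κJ κK : complexBetti M (2 * 1)),
      -- `κ_I, κ_J, κ_K` are the three Kähler classes `[ω_I], [ω_J], [ω_K]` read on `M(ℂ)`
      A.pullback 2 κI = ofRealClass A.carrier 2 (e A.carrier 2 (gm.kaehlerClass hω hHK.isKaehler)) →
      A.pullback 2 κJ = ofRealClass A.carrier 2 (e A.carrier 2 (deRhamCohomology.mk
        ⟨twoFormOf gm.toRiemannianMetric J, hHK.isSmoothForm_J, hHK.isClosedForm_J⟩)) →
      A.pullback 2 κK = ofRealClass A.carrier 2 (e A.carrier 2 (deRhamCohomology.mk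
        ⟨twoFormOf gm.toRiemannianMetric K, hHK.isSmoothForm_K, hHK.isClosedForm_K⟩)) →
      -- the matrix `(g^*κ_L ∪ g^*κ_L')_{L,L'}` is scalar: `⟨[g(Y)], ω_L²⟩` is constant on the sphere
      cupProduct (rfl : 2 * 1 + 2 * 1 = 2 * 2) (complexBetti.map g (2 * 1) κI)
          (complexBetti.map g (2 * 1) κI) =
        cupProduct (rfl : 2 * 1 + 2 * 1 = 2 * 2) (complexBetti.map g (2 * 1) κJ)
          (complexBetti.map g (2 * 1) κJ) →
      cupProduct (rfl : 2 * 1 + 2 * 1 = 2 * 2) (complexBetti.map g (2 * 1) κI)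
          (complexBetti.map g (2 * 1) κI) =
        cupProduct (rfl : 2 * 1 + 2 * 1 = 2 * 2) (complexBetti.map g (2 * 1) κK)
          (complexBetti.map g (2 * 1) κK) →
      cupProduct (rfl : 2 * 1 + 2 * 1 = 2 * 2) (complexBetti.map g (2 * 1) κI)
          (complexBetti.map g (2 * 1) κJ) = 0 →
      cupProduct (rfl : 2 * 1 + 2 * 1 = 2 * 2) (complexBetti.map g (2 * 1) κI)
          (complexBetti.map g (2 * 1) κK) = 0 →
      cupProduct (rfl : 2 * 1 + 2 * 1 = 2 * 2) (complexBetti.map g (2 * 1) κJ)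
          (complexBetti.map g (2 * 1) κK) = 0 →
      IsTrianalytic J K (A.toComplexPoints ⁻¹' Set.range (AlgPoints.map (L := ℂ) g))

end Literature.Geometry.Hyperkaehler

end
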